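import Mathlib
import Summits.Ventures.HodgeRepro2.T6N3SideRichToy
import Summits.Ventures.HodgeRepro2.T6N2RichForms

/-!
# T6N2RichFormsSeam — THE N2 SEAM TYPE-CHECKED ON d3's ACTUAL CARRIERS, with its joint toy: the four
line forms over t6-p3's rich N3 datum `N3DatumRich`, the N2 rich datum assembled from them, and the
instance on the toy rich datum `N3RichToy.toyRich` (owner t6-p5; imports t6-p3's T6N3SideRichToy and
this seat's T6N2RichForms)

`T6N2RichForms.lean` types the host obligation of RS-N2 in the objects / laws form over ANY N3 datum:
`N2Forms 𝒟` (four `LineForm`s: a ℚ-space of admissible choices read into each line's Schwartz data) under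
`N2Forms.IsForm`, and `N2Rich.ofForms Fm h : N2Rich 𝒟`. The host d3 is t6-p3's rich datum
`Rd : N3DatumRich` (STAGE 0, T6N3DatumRich, STATUS ll. 12431 / 12623): its datum of record is
`Rd.toDatum` and its lines' Schwartz data are the FIELDS `Rd.A.Sa`, `Rd.A.Sb`, `Rd.B.Sa`, `Rd.B.Sb` of the
rich sides (the `abbrev` bridge `N3SideRich.toSide` reduces `Rd.toDatum.A.Sa` to `Rd.A.Sa`). This file
is the seam:

* `N3DatumRich.N2FormsOn Rd := N2Forms Rd.toDatum` (an `abbrev`), and the witness that the forms live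
  on d3's own carriers (`N3DatumRich.lineA_of_forms : (Fm : Rd.N2FormsOn) → LineForm Rd.A.Sa := Fm.A`, …);
* `N3DatumRich.n2Rich Rd Fm h : N2Rich Rd.toDatum` (= `N2Rich.ofForms`, `rfl`), its datum
  `n2Rich_toDatum` (`rfl`), and the N2 block on a carrier `M : NAut3 F P` whose N3 datum IS `Rd.toDatum`
  (`N2_block_seam₃`, through `N2Rich.N2_block_forms₃`);
* THE JOINT TOY (§10.5(ii)(c)/(d)) on t6-p3's `N3RichToy.toyRich` (both sides `sideRich`: `Sa = Sb = ℂ`):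
  `toyLineForm : LineForm ℂ` (admissible choices `ℚ`, read by the cast `ℚ → ℂ`), whose admissible set IS
  t6-p3's `N3ToyV.ratSet` (`rfl`), `toyForms : N2RichToy.toyRich.N2FormsOn` (four copies),
  `toyForms_isForm` (ℚ-linearity = `Rat.cast_mul`; spanning = t6-p3's `N3ToyV.span_ratSet`),
  `toyN2Rich := toyRich.n2Rich toyForms toyForms_isForm`, with `toyN2Rich_admA … = ratSet` (`rfl`) and
  `toyN2Rich_toDatum : toyN2Rich.toDatum F P = toyIsoSF F P N3RichToy.toy ratSet ratSet ratSet ratSet`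
  (`rfl`) — the ℚ-rational N2 datum of the joint toy of record (T6N2Rich `N2Rich.rat`, T6N3Toy2V,
  t6-p3's `witN2`), now on the RICH carrier; `toy_joint`: N2's conclusion, the sentence N2 and N3 share,
  and the four EX binders hold on it with no hypothesis, TOGETHER WITH t6-p3's rich N3 conclusions
  (`N3RichToy.toyRich_N3A` / `_N3B`) on the same datum;
* `ratSpan_ratSet : ratSpan N3ToyV.ratSet = N3ToyV.ratSet` — the toy's ℚ-form property read through
  `LineForm.ratSpan_adm` (a cross-check of T6N2RatForm `ratRange_eq_ratSpan_singleton_one`).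

HOST OBLIGATION OF RS-N2 ON d3 BY NAME: per line 1 DATA (`LineForm Rd.<side>.S<a|b>`) + 1 RESIDUAL
(`IsForm`), i.e. 4 + 4 over the whole datum, plus the assembly's construction equation `hR`; nothing of
t6-p3's is touched, nothing is consumed by any theorem of record; proof lane (`abbrev`s, `def`s, `rfl`
theorems, one conjunction).

README §8(d): uses an L-value-free non-vanishing device: NO (TIER5 §N2, a pre-02:16Z line of record —
N2 asserts no non-vanishing — continued).

Filed in Tier-6 WAVE 1 as p438661 (proposed 2026-08-26T10:40:10Z, ACCEPTED, commit 65f26d82388c);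
this v2 differs from the filed bytes in this module docstring only (the staged-record wording
dropped; every declaration byte-identical to v1).
-/

namespace Summit.Ventures.HodgeRepro2.T6

open Summit.Ventures.HodgeRepro2
open Summit.Ventures.HodgeRepro2.T5DatumSimilitude
open Summit.Ventures.HodgeRepro2.T5CubeTypes
open Summit.Ventures.HodgeRepro2.T6.N2ToyIso
open Summit.Ventures.HodgeRepro2.T6.N2ToyIsoS
open Summit.Ventures.HodgeRepro2.T6.N2RatForm

/-! ## 1. The seam: the four line forms over a rich N3 datum, on its own carriers -/

namespace N3DatumRich

variable (Rd : N3DatumRich)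

/-- THE FOUR LINE FORMS OVER A RICH N3 DATUM: `N2Forms` of its datum of record (an `abbrev`, so that
the forms' carriers reduce to the fields of the rich sides). -/
abbrev N2FormsOn := N2Forms Rd.toDatum

/-- The form of line `111` of `Fm : Rd.N2FormsOn` lives on d3's own carrier `Rd.A.Sa`. -/
abbrev lineA_of_forms (Fm : Rd.N2FormsOn) : LineForm Rd.A.Sa := Fm.A

/-- Line `100`: on `Rd.A.Sb`. -/
abbrev lineB_of_forms (Fm : Rd.N2FormsOn) : LineForm Rd.A.Sb := Fm.B

/-- Line `101`: on `Rd.B.Sa`. -/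
abbrev lineC_of_forms (Fm : Rd.N2FormsOn) : LineForm Rd.B.Sa := Fm.C

/-- Line `110`: on `Rd.B.Sb`. -/
abbrev lineD_of_forms (Fm : Rd.N2FormsOn) : LineForm Rd.B.Sb := Fm.D

/-- THE N2 RICH DATUM OF THE HOST d3 from its four line forms under their laws (= `N2Rich.ofForms`). -/
noncomputable def n2Rich (Fm : Rd.N2FormsOn) (h : Fm.IsForm) : N2Rich Rd.toDatum :=
  N2Rich.ofForms Fm h

/-- `n2Rich` is `N2Rich.ofForms` (`rfl`). -/
theorem n2Rich_eq_ofForms (Fm : Rd.N2FormsOn) (h : Fm.IsForm) :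
    Rd.n2Rich Fm h = N2Rich.ofForms Fm h := rfl

/-- The admissible set of line `111` on d3 is the image of its admissible choices (`rfl`). -/
theorem n2Rich_admA (Fm : Rd.N2FormsOn) (h : Fm.IsForm) :
    (Rd.n2Rich Fm h).admA = Set.range (Rd.lineA_of_forms Fm).ev := rfl

variable {K : Type*} [Field K] [NumberField K] [NumberField.IsCMField K]

/-- The N2 datum of the host d3 constructed from its forms: `toyIsoSF` at the four images (`rfl`). -/
theorem n2Rich_toDatum (Fm : Rd.N2FormsOn) (h : Fm.IsForm) (F : FaceSetting K) (P : NDatum F) :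
    (Rd.n2Rich Fm h).toDatum F P =
      toyIsoSF F P Rd.toDatum Fm.A.adm Fm.B.adm Fm.C.adm Fm.D.adm := rfl

/-- THE N2 BLOCK ON A CARRIER WHOSE N3 DATUM IS THE RICH d3: for `M : NAut3 F P` with `M.d3 = Rd.toDatum`
(as the assembly builds it), the forms on d3 under their laws and the construction equation give
`M.AdmDatum ∧ M.d2.AdmGenerating`. -/
theorem N2_block_seam₃ {F : FaceSetting K} {P : NDatum F} (M : NAut3 F P) (Fm : N2Forms M.d3)
    (h : Fm.IsForm) (hR : M.d2 = (N2Rich.ofForms Fm h).toDatum F P) :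
    M.AdmDatum ∧ M.d2.AdmGenerating :=
  N2Rich.N2_block_forms₃ M Fm h hR

/-- A v1 carrier over the rich d3 with the forms' datum adjoined has the N2 block with no hypothesis
beyond the laws. -/
theorem ofNAut_n2Rich_block {F : FaceSetting K} {P : NDatum F} (M₁ : NAut F P) (Fm : N2Forms M₁.d3)
    (h : Fm.IsForm) :
    (NAut3.ofNAut M₁ ((N2Rich.ofForms Fm h).toDatum F P)).AdmDatum ∧
      (NAut3.ofNAut M₁ ((N2Rich.ofForms Fm h).toDatum F P)).d2.AdmGenerating :=
  N2Rich.ofNAut_ofForms_block M₁ Fm h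

end N3DatumRich

/-! ## 2. The joint toy on t6-p3's toy rich datum -/

namespace N2RichToy

open Summit.Ventures.HodgeRepro2.T6.N3RichToy

/-- THE TOY LINE FORM on the toy Schwartz space `ℂ`: admissible choices `ℚ`, read by the cast
`ℚ → ℂ` (the ℚ-form of the toy's Schwartz space, t6-p3's `N3ToyV.ratSet`). -/
noncomputable def toyLineForm : LineForm ℂ where
  Q := ℚ
  ev := (Rat.castHom ℂ).toAddMonoidHom

/-- `toyLineForm.ev q = (q : ℂ)`. -/
theorem toyLineForm_ev_apply (q : ℚ) : toyLineForm.ev q = (q : ℂ) := rfl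

/-- THE TOY ADMISSIBLE SET IS t6-p3's `ratSet` (`rfl`). -/
theorem toyLineForm_adm : toyLineForm.adm = N3ToyV.ratSet := rfl

/-- The cast is ℚ-linear (stated on `ℚ` with its standard ℚ-structure). -/
theorem castHom_smul (q a : ℚ) :
    (Rat.castHom ℂ).toAddMonoidHom (q • a) = (q : ℂ) • (Rat.castHom ℂ).toAddMonoidHom a := by
  simp [smul_eq_mul]

/-- THE LAWS HOLD on the toy line form: ℚ-linearity of the cast, and ℂ-spanning of `ratSet`
(t6-p3's `N3ToyV.span_ratSet`). -/
theorem toyLineForm_isForm : toyLineForm.IsForm where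
  ratSmul q a := castHom_smul q a
  spans := by
    rw [toyLineForm_adm]
    exact N3ToyV.span_ratSet

/-- THE TOY'S ℚ-FORM PROPERTY: `ratSet` is its own `ratSpan` (T6N2RatForm), read through the line form. -/
theorem ratSpan_ratSet : ratSpan N3ToyV.ratSet = N3ToyV.ratSet := by
  rw [← toyLineForm_adm]
  exact toyLineForm.ratSpan_adm toyLineForm_isForm

/-- THE FOUR TOY LINE FORMS on the toy rich datum (both sides `sideRich`, `Sa = Sb = ℂ`): the carriers of
`toyRich.N2FormsOn` are exactly `ℂ`, so `toyLineForm` is a form on each line. -/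
noncomputable def toyForms : toyRich.N2FormsOn :=
  ⟨toyLineForm, toyLineForm, toyLineForm, toyLineForm⟩

/-- The laws hold on the four toy line forms. -/
theorem toyForms_isForm : toyForms.IsForm :=
  ⟨toyLineForm_isForm, toyLineForm_isForm, toyLineForm_isForm, toyLineForm_isForm⟩

/-- THE N2 RICH DATUM OF THE TOY RICH d3 through the seam. -/
noncomputable def toyN2Rich : N2Rich toy :=
  toyRich.n2Rich toyForms toyForms_isForm

/-- Its admissible sets are t6-p3's `ratSet` (`rfl`): line `111`. -/
theorem toyN2Rich_admA : toyN2Rich.admA = N3ToyV.ratSet := rfl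

/-- Line `100`. -/
theorem toyN2Rich_admB : toyN2Rich.admB = N3ToyV.ratSet := rfl

/-- Line `101`. -/
theorem toyN2Rich_admC : toyN2Rich.admC = N3ToyV.ratSet := rfl

/-- Line `110`. -/
theorem toyN2Rich_admD : toyN2Rich.admD = N3ToyV.ratSet := rfl

variable {K : Type*} [Field K] [NumberField K] [NumberField.IsCMField K]
variable (F : FaceSetting K) (P : NDatum F)

/-- THE N2 DATUM OF THE TOY RICH d3 IS THE ℚ-RATIONAL N2 DATUM OF THE JOINT TOY OF RECORD, on the rich
carrier: `toyIsoSF F P toy ratSet ratSet ratSet ratSet` (`rfl`; cf. T6N2Rich `N2Rich.rat_toDatum` on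
`N3ToyV.toyVW`, t6-p3's `witN2`). -/
theorem toyN2Rich_toDatum :
    toyN2Rich.toDatum F P =
      toyIsoSF F P toy N3ToyV.ratSet N3ToyV.ratSet N3ToyV.ratSet N3ToyV.ratSet := rfl

/-- N2's conclusion on the toy rich d3, no hypothesis. -/
theorem toyN2Rich_adm : (toyN2Rich.toDatum F P).Adm := toyN2Rich.toDatum_adm F P

/-- The sentence N2 and N3 share on the toy rich d3, no hypothesis. -/
theorem toyN2Rich_admGenerating : (toyN2Rich.toDatum F P).AdmGenerating :=
  toyN2Rich.toDatum_admGenerating F P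

/-- THE JOINT TOY OF THE N2 SEAM: on t6-p3's toy rich datum, N2's conclusion, the sentence N2 and N3
share, and the four EX binders of v6 hold on the N2 datum assembled from the four toy line forms —
TOGETHER WITH t6-p3's rich N3 conclusions on the same datum (`N3RichToy.toyRich_N3A` / `_N3B`): the
binder set of T6N3DatumRich + T6N2RichForms + this seam is jointly satisfiable in kernel. -/
theorem toy_joint :
    (toyN2Rich.toDatum F P).Adm ∧ (toyN2Rich.toDatum F P).AdmGenerating ∧
      (IsCMFrame (toyN2Rich.toDatum F P).τ ∧
        IsLiuSignElement K ((toyN2Rich.toDatum F P).type t111) (toyN2Rich.toDatum F P).e₁₁₁ ∧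
        MagSpec (toyN2Rich.toDatum F P).τ (toyN2Rich.toDatum F P).u ∧
        (toyN2Rich.toDatum F P).e₁₀₀ =
          (toyN2Rich.toDatum F P).u * (1 - (toyN2Rich.toDatum F P).u) *
            (toyN2Rich.toDatum F P).e₁₁₁) ∧
      toy.ellNonzero toy.A ∧ toy.ellNonzero toy.B :=
  ⟨toyN2Rich.toDatum_adm F P, toyN2Rich.toDatum_admGenerating F P,
    toyN2Rich.toDatum_explicitShape F P, toyRich_N3A, toyRich_N3B⟩

end N2RichToy

end Summit.Ventures.HodgeRepro2.T6
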